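import Summits.CriticalPhenomena.Ising3DConformalLimit.Theorems.PerfectScreeningCoulombImpliesNontrivialSusceptibilityOfIsotherm
import HarnessLib

/-!
# The anchored GHS sum rule at `β_c` on `ℤ³` (stub `stub_truncatedSumRule`, line `Sketch` — magnetic ruler)

Crux `UniformRegularity` of route `SynchronousCoupling` (Ising3DConformalLimit), item
stmt-CriticalPhenomena-4658, registered stub 4 of the lead skeleton `Cruxes/UniformRegularity/Lines/Sketch.lean`.

With `M(h) := ⟨σ₀⟩⁺_{β_c,h}` (`magnetizationInField 3 (criticalBeta 3) h`) and
`S_h(x) := ⟨σ₀σ_x⟩⁺_{β_c,h}` (`plusCorr 3 (criticalBeta 3) h {0, x}`), for every `h > 0` and every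
finite `Λ ⊂ ℤ³` not containing the origin,

  `β_c · h · Σ_{x ∈ Λ} (S_h(x) − M(h)²) ≤ M(h)`

(the pointwise Buckingham–Gunton calibration, Fernández–Fröhlich–Sokal 1992, §14.3.5: the weak GHS
bound `χ ≤ M/h` on the susceptibility in a field). Proof: in a plus box `B ⊇ Λ ∪ {0}` the one-point
function `s ↦ ⟨σ₀⟩⁺_{B;β,s}` is concave on `[0, ∞)` (GHS) with derivative
`β Σ_{y ∈ B} ⟨σ₀;σ_y⟩⁺_{B;β,s}`, nonincreasing in `s`, and is nonnegative at `s = 0` (GKS I), whence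
`β h Σ_{y ∈ B} ⟨σ₀;σ_y⟩⁺_{B;β,h} ≤ ⟨σ₀⟩⁺_{B;β,h}`; the truncated terms are nonnegative (FKG), so the
sum may be restricted to `Λ`; then `B ↑ ℤ³` termwise (plus boxes converge on local observables,
translation invariance `⟨σ_x⟩⁺ = M`). All of this is the landed tree theorem
`PerfectScreeningCoulombImpliesNontrivial.sum_plusTrunc_le_mag_div`
(`Σ_{x∈Λ} (⟨σ₀σ_x⟩⁺_{β,h} − m(β,h)²) ≤ m(β,h)/(βh)` for `β, h > 0`, any `d`), which this file
specialises to `d = 3`, `β = β_c(3) > 0` (`criticalBeta_pos_holds`), rewriting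
`⟨σ₀σ_x⟩ = ⟨σ_{{0,x}}⟩` for `x ≠ 0` and clearing the denominator.

References: Fernández–Fröhlich–Sokal 1992, §14.3.5 [FFS1992]; Lebowitz 1974 (GHS) [Lebowitz1974];
Friedli–Velenik 2017, §3.6–3.7, Remark 3.41 [FriedliVelenik2017].
-/

noncomputable section

namespace Summit.CriticalPhenomena.Ising3DConformalLimit.Theorems.MagneticRuler

open Literature.Probability.LatticeModels Finset
open Summit.CriticalPhenomena.Ising3DConformalLimit.PerfectScreeningCoulombImpliesNontrivial
open scoped BigOperators

/-- `σ_{{x,y}} = σ_x σ_y` for `x ≠ y` (the pair spin product is the spin pair). [folklore] -/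
theorem spinProduct_pair_eq_spinPair_of_ne {V : Type*} [DecidableEq V] {x y : V} (hxy : x ≠ y) :
    spinProduct ({x, y} : Finset V) = spinPair x y := by
  funext σ
  rw [spinProduct, Finset.prod_pair hxy, spinPair]

/-- For `x ≠ 0`, the plus-state correlation of `{0, x}` is the plus-state expectation of `σ₀σ_x`:
`⟨σ_{{0,x}}⟩⁺_{β,h} = ⟨σ₀σ_x⟩⁺_{β,h}`. [cite: FriedliVelenik2017, §3.6.1] -/
theorem plusCorr_pair_eq_plusExpect_spinPair {d : ℕ} (β h : ℝ) {x : Site d} (hx : (0 : Site d) ≠ x) :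
    plusCorr d β h {0, x} = plusExpect d β h (spinPair 0 x) := by
  rw [plusCorr, spinProduct_pair_eq_spinPair_of_ne hx]

/-- **The weak GHS sum rule, cleared of denominators**: for `β > 0`, `h > 0` and every finite
`Λ ⊂ ℤ^d` with `0 ∉ Λ`, `β · h · Σ_{x∈Λ} (⟨σ_{{0,x}}⟩⁺_{β,h} − m(β,h)²) ≤ m(β,h)` (from the tree's
`sum_plusTrunc_le_mag_div`: GHS concavity of the finite-volume magnetisation in the field anchored at the
nonnegative zero-field value, FKG positivity of the truncated terms, plus boxes `↑ ℤ^d`).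
[cite: Lebowitz1974, §2, Remark (ii) following the proof of the Theorem] [cite: FriedliVelenik2017, Remark 3.41 (p. 126)] -/
theorem truncatedSumRule_of_pos {d : ℕ} {β : ℝ} (hβ : 0 < β) {h : ℝ} (hh : 0 < h)
    (Λ : Finset (Site d)) (hΛ : (0 : Site d) ∉ Λ) :
    β * h * ∑ x ∈ Λ, (plusCorr d β h {0, x} - (magnetizationInField d β h) ^ 2) ≤
      magnetizationInField d β h := by
  have hsum : ∑ x ∈ Λ, (plusCorr d β h {0, x} - (magnetizationInField d β h) ^ 2) =
      ∑ x ∈ Λ, (plusExpect d β h (spinPair 0 x) - (magnetizationInField d β h) ^ 2) := by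
    refine Finset.sum_congr rfl fun x hx => ?_
    have hx0 : (0 : Site d) ≠ x := by
      rintro rfl
      exact hΛ hx
    rw [plusCorr_pair_eq_plusExpect_spinPair β h hx0]
  have hχ := sum_plusTrunc_le_mag_div (d := d) hβ hh Λ
  rw [le_div_iff₀ (mul_pos hβ hh)] at hχ
  rw [hsum]
  exact (mul_comm _ _).trans_le hχ

/-- **STUB 4 · `stub_truncatedSumRule`** (the anchored Buckingham–Gunton sum rule at `β_c` on `ℤ³`):
for `h > 0` and every finite `Λ ∌ 0`,
`β_c · h · Σ_{x∈Λ} (⟨σ₀σ_x⟩⁺_{β_c,h} − M(h)²) ≤ M(h)`, `M(h) = ⟨σ₀⟩⁺_{β_c,h}` — GHS concavity of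
`s ↦ ⟨σ₀⟩⁺_{Λ_L;β_c,s}` on `[0,h]`, `∂_s⟨σ₀⟩ = β Σ_y ⟨σ₀;σ_y⟩ ≥ β Σ_{y∈Λ} ⟨σ₀;σ_y⟩`, then `L → ∞`;
here `β_c(3) > 0` by `criticalBeta_pos_holds`.
[cite: Lebowitz1974, §2, Remark (ii) following the proof of the Theorem] [cite: FriedliVelenik2017, Remark 3.41 (p. 126)] -/
theorem stub_truncatedSumRule : ∀ h : ℝ, 0 < h → ∀ Λ : Finset (Literature.Probability.LatticeModels.Site 3), (0 : Literature.Probability.LatticeModels.Site 3) ∉ Λ → Literature.Probability.LatticeModels.criticalBeta 3 * h * ∑ x ∈ Λ, (Literature.Probability.LatticeModels.plusCorr 3 (Literature.Probability.LatticeModels.criticalBeta 3) h {0, x} - (Literature.Probability.LatticeModels.magnetizationInField 3 (Literature.Probability.LatticeModels.criticalBeta 3) h) ^ 2) ≤ Literature.Probability.LatticeModels.magnetizationInField 3 (Literature.Probability.LatticeModels.criticalBeta 3) h := by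
  intro h hh Λ hΛ
  exact truncatedSumRule_of_pos (criticalBeta_pos_holds (d := 3) (by norm_num)) hh Λ hΛ

end Summit.CriticalPhenomena.Ising3DConformalLimit.Theorems.MagneticRuler

end
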